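import Mathlib
import Literature.MathematicalPhysics.QuantumLattice.Imbrie2016.FlagSumThreeSharp

/-!
# Branch-and-bound checker for LEMMA I of THEOREM N3♯  [b2b-imbrie seat 2, DENSITY-XY G.64]

Part 1 of the kernel discharge of the named fact `PhiSharpCore` (`FlagSumThreeSharp`): a rational
box checker `PhiSharpBB.checkT` (tightening by positivity / caps `≤ 3/4` / `wₖ + ηₖ ≤ 1`; monotone box
lower bound for the crude six-flag sum `G6 w η 1 1`; widest-first midpoint splitting; a list of
*trusted* boxes certified elsewhere), its SOUNDNESS over `ℝ` (`checkT_sound`), the nine chunk boxes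
of the search tree, and the kernel evaluation (`decide +kernel`) of the three small chunks.  The six
large chunks are evaluated in `FlagSumThreeSharpCert1/2`, the assembly is `FlagSumThreeSharpCore`.
The checker mirrors pub-imbrie code/seat2-g16/bb_core.py / bb_twin.py exactly (3627 certified leaves,
9685 nodes, depth ≤ 21).  Elementary; nothing about LLA / CONJECTURE K is asserted.
-/

namespace Literature.MathematicalPhysics.QuantumLattice.Imbrie2016

namespace PhiSharpBB

/-- [folklore] A box in the coordinates `(w₁, w₂, η₁, η₂)` with rational endpoints
(`w₃ = 1 - w₁ - w₂`, `η₃ = 1 - η₁ - η₂` are implied). -/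
structure Box where
  /-- lower end for `w₁` -/
  w1l : ℚ
  /-- upper end for `w₁` -/
  w1h : ℚ
  /-- lower end for `w₂` -/
  w2l : ℚ
  /-- upper end for `w₂` -/
  w2h : ℚ
  /-- lower end for `η₁` -/
  e1l : ℚ
  /-- upper end for `η₁` -/
  e1h : ℚ
  /-- lower end for `η₂` -/
  e2l : ℚ
  /-- upper end for `η₂` -/
  e2h : ℚ
  deriving DecidableEq

/-- [folklore] Tightened intervals for all six coordinates `w₁, w₂, w₃, η₁, η₂, η₃`. -/
structure TBox where
  /-- `w₁` lower -/
  W1l : ℚ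
  /-- `w₁` upper -/
  W1h : ℚ
  /-- `w₂` lower -/
  W2l : ℚ
  /-- `w₂` upper -/
  W2h : ℚ
  /-- `w₃` lower -/
  W3l : ℚ
  /-- `w₃` upper -/
  W3h : ℚ
  /-- `η₁` lower -/
  E1l : ℚ
  /-- `η₁` upper -/
  E1h : ℚ
  /-- `η₂` lower -/
  E2l : ℚ
  /-- `η₂` upper -/
  E2h : ℚ
  /-- `η₃` lower -/
  E3l : ℚ
  /-- `η₃` upper -/
  E3h : ℚ

/-- [folklore] Tightening of a box by positivity, the caps `≤ 3/4` and `wₖ + ηₖ ≤ 1`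
(exactly as in bb_core.py). -/
def tighten (b : Box) : TBox :=
  { W1l := max b.w1l 0
    W1h := min (min b.w1h (3 / 4)) (1 - max b.e1l 0)
    W2l := max b.w2l 0
    W2h := min (min b.w2h (3 / 4)) (1 - max b.e2l 0)
    W3l := max (1 - b.w1h - b.w2h) 0
    W3h := min (min (1 - b.w1l - b.w2l) (3 / 4)) (1 - max (1 - b.e1h - b.e2h) 0)
    E1l := max b.e1l 0
    E1h := min (min b.e1h (3 / 4)) (1 - max b.w1l 0)
    E2l := max b.e2l 0
    E2h := min (min b.e2h (3 / 4)) (1 - max b.w2l 0)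
    E3l := max (1 - b.e1h - b.e2h) 0
    E3h := min (min (1 - b.e1l - b.e2l) (3 / 4)) (1 - max (1 - b.w1h - b.w2h) 0) }

/-- [folklore] Lower bound for the first factor `min(1, 2w²/η)` on `w ≥ wl ≥ 0`, `0 < η ≤ eh`. -/
def f1 (wl eh : ℚ) : ℚ := if 0 < eh then min 1 (2 * wl * wl / eh) else 1

/-- [folklore] Lower bound for the second factor `min(1, 2η²/w)` on `η ≥ el ≥ 0`, `0 < w ≤ wh`. -/
def f2 (el wh : ℚ) : ℚ := if 0 < wh then min 1 (2 * el * el / wh) else 1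

/-- [folklore] Monotone box lower bound for one flag term `coreTerm w η 1 1`. -/
def lbT (wl wh el eh : ℚ) : ℚ := f1 wl eh * f2 el wh

/-- [folklore] Box lower bound for the crude six-flag sum `G6 w η 1 1`. -/
def lb (t : TBox) : ℚ :=
  lbT t.W1l t.W1h t.E2l t.E2h + lbT t.W1l t.W1h t.E3l t.E3h + lbT t.W2l t.W2h t.E1l t.E1h
    + lbT t.W2l t.W2h t.E3l t.E3h + lbT t.W3l t.W3h t.E1l t.E1h + lbT t.W3l t.W3h t.E2l t.E2h

/-- [folklore] The tightened box is empty. -/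
def infeasible (t : TBox) : Bool :=
  decide (t.W1h < t.W1l) || decide (t.W2h < t.W2l) || decide (t.W3h < t.W3l)
    || decide (t.E1h < t.E1l) || decide (t.E2h < t.E2l) || decide (t.E3h < t.E3l)

/-- [folklore] The tightened box contains no point of the chamber `w₁ ≥ w₂ ≥ w₃`. -/
def symPruned (t : TBox) : Bool := decide (t.W1h < t.W2l) || decide (t.W2h < t.W3l)

/-- [folklore] Leaf test: empty, or outside the ordered chamber, or certified bound `≥ 1`. -/
def leafOK (b : Box) : Bool :=
  infeasible (tighten b) || symPruned (tighten b) || decide (1 ≤ lb (tighten b))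

/-- [folklore] Midpoint split of the widest coordinate (first index among ties, as Python's `max`). -/
def split (b : Box) : Box × Box :=
  if b.w2h - b.w2l ≤ b.w1h - b.w1l ∧ b.e1h - b.e1l ≤ b.w1h - b.w1l ∧ b.e2h - b.e2l ≤ b.w1h - b.w1l then
    ({ b with w1h := (b.w1l + b.w1h) / 2 }, { b with w1l := (b.w1l + b.w1h) / 2 })
  else if b.e1h - b.e1l ≤ b.w2h - b.w2l ∧ b.e2h - b.e2l ≤ b.w2h - b.w2l then
    ({ b with w2h := (b.w2l + b.w2h) / 2 }, { b with w2l := (b.w2l + b.w2h) / 2 })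
  else if b.e2h - b.e2l ≤ b.e1h - b.e1l then
    ({ b with e1h := (b.e1l + b.e1h) / 2 }, { b with e1l := (b.e1l + b.e1h) / 2 })
  else
    ({ b with e2h := (b.e2l + b.e2h) / 2 }, { b with e2l := (b.e2l + b.e2h) / 2 })

/-- [folklore] Boolean list membership by derived decidable equality. -/
def memB (b : Box) : List Box → Bool
  | [] => false
  | c :: cs => decide (b = c) || memB b cs

/-- [folklore] The branch-and-bound checker with fuel `n` and a list of trusted boxes
(boxes certified by separate kernel evaluations). -/
def checkT (trusted : List Box) : ℕ → Box → Bool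
  | 0, b => leafOK b || memB b trusted
  | n + 1, b => leafOK b || memB b trusted
      || (checkT trusted n (split b).1 && checkT trusted n (split b).2)

/-! ### Soundness over `ℝ` -/

/-- [folklore] The real point `(w₁, w₂, η₁, η₂)` lies in the box. -/
def Box.mem (b : Box) (w1 w2 e1 e2 : ℝ) : Prop :=
  (b.w1l : ℝ) ≤ w1 ∧ w1 ≤ (b.w1h : ℝ) ∧ (b.w2l : ℝ) ≤ w2 ∧ w2 ≤ (b.w2h : ℝ)
    ∧ (b.e1l : ℝ) ≤ e1 ∧ e1 ≤ (b.e1h : ℝ) ∧ (b.e2l : ℝ) ≤ e2 ∧ e2 ≤ (b.e2h : ℝ)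

/-- [folklore] The hypotheses of `PhiSharpCore` together with the chamber condition `w₃ ≤ w₂ ≤ w₁`. -/
def Hyp (w1 w2 w3 e1 e2 e3 : ℝ) : Prop :=
  0 < w1 ∧ 0 < w2 ∧ 0 < w3 ∧ 0 < e1 ∧ 0 < e2 ∧ 0 < e3 ∧ w1 + w2 + w3 = 1 ∧ e1 + e2 + e3 = 1
    ∧ w1 + e1 ≤ 1 ∧ w2 + e2 ≤ 1 ∧ w3 + e3 ≤ 1 ∧ w1 ≤ 3 / 4 ∧ w2 ≤ 3 / 4 ∧ w3 ≤ 3 / 4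
    ∧ e1 ≤ 3 / 4 ∧ e2 ≤ 3 / 4 ∧ e3 ≤ 3 / 4 ∧ w3 ≤ w2 ∧ w2 ≤ w1

/-- [folklore] A box is *sound* if the crude flag sum is `≥ 1` at every admissible point of it. -/
def Sound (b : Box) : Prop :=
  ∀ w1 w2 w3 e1 e2 e3 : ℝ, b.mem w1 w2 e1 e2 → Hyp w1 w2 w3 e1 e2 e3 →
    1 ≤ G6 w1 w2 w3 e1 e2 e3 1 1

/-- [folklore] The box bound for one term is a lower bound of the term. -/
theorem lbT_le {wl wh el eh : ℚ} {w e : ℝ} (hw0 : 0 < w) (he0 : 0 < e) (hwl0 : 0 ≤ wl)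
    (hel0 : 0 ≤ el) (h1 : (wl : ℝ) ≤ w) (h2 : w ≤ (wh : ℝ)) (h3 : (el : ℝ) ≤ e)
    (h4 : e ≤ (eh : ℝ)) : ((lbT wl wh el eh : ℚ) : ℝ) ≤ coreTerm w e 1 1 := by
  have heh : (0 : ℚ) < eh := by exact_mod_cast he0.trans_le h4
  have hwh : (0 : ℚ) < wh := by exact_mod_cast hw0.trans_le h2
  have hwl0' : (0 : ℝ) ≤ wl := by exact_mod_cast hwl0
  have hel0' : (0 : ℝ) ≤ el := by exact_mod_cast hel0
  have heh' : (0 : ℝ) < eh := by exact_mod_cast heh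
  have hwh' : (0 : ℝ) < wh := by exact_mod_cast hwh
  unfold lbT f1 f2 coreTerm
  rw [if_pos heh, if_pos hwh]
  push_cast
  have g1 : 2 * (wl : ℝ) * wl / eh ≤ 2 * w ^ 2 / (e * 1) := by
    rw [div_le_div_iff₀ heh' (by positivity)]
    have a : (wl : ℝ) * wl ≤ w * w := mul_le_mul h1 h1 hwl0' hw0.le
    nlinarith [mul_le_mul_of_nonneg_right a he0.le, mul_le_mul_of_nonneg_left h4 (mul_self_nonneg w)]
  have g2 : 2 * (el : ℝ) * el / wh ≤ 2 * e ^ 2 / (1 * w) := by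
    rw [div_le_div_iff₀ hwh' (by positivity)]
    have a : (el : ℝ) * el ≤ e * e := mul_le_mul h3 h3 hel0' he0.le
    nlinarith [mul_le_mul_of_nonneg_right a hw0.le, mul_le_mul_of_nonneg_left h2 (mul_self_nonneg e)]
  exact mul_le_mul (min_le_min le_rfl g1) (min_le_min le_rfl g2)
    (le_min zero_le_one (by positivity)) (le_min zero_le_one (by positivity))

/-- [folklore] A box passing the leaf test is sound. -/
theorem leafOK_sound (b : Box) (h : leafOK b = true) : Sound b := by
  intro w1 w2 w3 e1 e2 e3 hm H
  obtain ⟨m1, m2, m3, m4, m5, m6, m7, m8⟩ := hm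
  obtain ⟨hw1, hw2, hw3, he1, he2, he3, hsw, hse, hc1, hc2, hc3, cw1, cw2, cw3, ce1, ce2, ce3,
    h32, h21⟩ := H
  -- the point lies in the tightened box
  have l1 : ((tighten b).W1l : ℝ) ≤ w1 := by simp only [tighten]; push_cast; exact max_le m1 hw1.le
  have l2 : ((tighten b).W2l : ℝ) ≤ w2 := by simp only [tighten]; push_cast; exact max_le m3 hw2.le
  have l3 : ((tighten b).W3l : ℝ) ≤ w3 := by
    simp only [tighten]; push_cast; exact max_le (by linarith) hw3.le
  have l4 : ((tighten b).E1l : ℝ) ≤ e1 := by simp only [tighten]; push_cast; exact max_le m5 he1.le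
  have l5 : ((tighten b).E2l : ℝ) ≤ e2 := by simp only [tighten]; push_cast; exact max_le m7 he2.le
  have l6 : ((tighten b).E3l : ℝ) ≤ e3 := by
    simp only [tighten]; push_cast; exact max_le (by linarith) he3.le
  have u1 : w1 ≤ ((tighten b).W1h : ℝ) := by
    simp only [tighten]; push_cast
    exact le_min (le_min m2 cw1) (by linarith [max_le (b := (0:ℝ)) m5 he1.le])
  have u2 : w2 ≤ ((tighten b).W2h : ℝ) := by
    simp only [tighten]; push_cast
    exact le_min (le_min m4 cw2) (by linarith [max_le (b := (0:ℝ)) m7 he2.le])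
  have u3 : w3 ≤ ((tighten b).W3h : ℝ) := by
    simp only [tighten]; push_cast
    refine le_min (le_min (by linarith) cw3) ?_
    have : max (1 - (b.e1h : ℝ) - b.e2h) 0 ≤ e3 := max_le (by linarith) he3.le
    linarith
  have u4 : e1 ≤ ((tighten b).E1h : ℝ) := by
    simp only [tighten]; push_cast
    exact le_min (le_min m6 ce1) (by linarith [max_le (b := (0:ℝ)) m1 hw1.le])
  have u5 : e2 ≤ ((tighten b).E2h : ℝ) := by
    simp only [tighten]; push_cast
    exact le_min (le_min m8 ce2) (by linarith [max_le (b := (0:ℝ)) m3 hw2.le])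
  have u6 : e3 ≤ ((tighten b).E3h : ℝ) := by
    simp only [tighten]; push_cast
    refine le_min (le_min (by linarith) ce3) ?_
    have : max (1 - (b.w1h : ℝ) - b.w2h) 0 ≤ w3 := max_le (by linarith) hw3.le
    linarith
  have n1 : 0 ≤ (tighten b).W1l := by simp only [tighten]; exact le_max_right _ _
  have n2 : 0 ≤ (tighten b).W2l := by simp only [tighten]; exact le_max_right _ _
  have n3 : 0 ≤ (tighten b).W3l := by simp only [tighten]; exact le_max_right _ _
  have n4 : 0 ≤ (tighten b).E1l := by simp only [tighten]; exact le_max_right _ _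
  have n5 : 0 ≤ (tighten b).E2l := by simp only [tighten]; exact le_max_right _ _
  have n6 : 0 ≤ (tighten b).E3l := by simp only [tighten]; exact le_max_right _ _
  simp only [leafOK, infeasible, symPruned, Bool.or_eq_true, decide_eq_true_eq] at h
  rcases h with (hinf | hsym) | hlb
  · exfalso
    rcases hinf with ((((i | i) | i) | i) | i) | i
    · exact absurd (l1.trans u1) (not_le.2 (by exact_mod_cast i))
    · exact absurd (l2.trans u2) (not_le.2 (by exact_mod_cast i))
    · exact absurd (l3.trans u3) (not_le.2 (by exact_mod_cast i))
    · exact absurd (l4.trans u4) (not_le.2 (by exact_mod_cast i))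
    · exact absurd (l5.trans u5) (not_le.2 (by exact_mod_cast i))
    · exact absurd (l6.trans u6) (not_le.2 (by exact_mod_cast i))
  · exfalso
    rcases hsym with i | i
    · exact absurd ((l2.trans h21).trans u1) (not_le.2 (by exact_mod_cast i))
    · exact absurd ((l3.trans h32).trans u2) (not_le.2 (by exact_mod_cast i))
  · have hlb' : (1 : ℝ) ≤ ((lb (tighten b) : ℚ) : ℝ) := by exact_mod_cast hlb
    have t12 := lbT_le hw1 he2 n1 n5 l1 u1 l5 u5
    have t13 := lbT_le hw1 he3 n1 n6 l1 u1 l6 u6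
    have t21 := lbT_le hw2 he1 n2 n4 l2 u2 l4 u4
    have t23 := lbT_le hw2 he3 n2 n6 l2 u2 l6 u6
    have t31 := lbT_le hw3 he1 n3 n4 l3 u3 l4 u4
    have t32 := lbT_le hw3 he2 n3 n5 l3 u3 l5 u5
    unfold lb at hlb'
    push_cast at hlb'
    unfold G6
    linarith

/-- [folklore] If both halves of a box are sound, the box is sound. -/
theorem split_sound (b : Box) (h1 : Sound (split b).1) (h2 : Sound (split b).2) : Sound b := by
  intro w1 w2 w3 e1 e2 e3 hm H
  obtain ⟨m1, m2, m3, m4, m5, m6, m7, m8⟩ := hm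
  unfold split at h1 h2
  split_ifs at h1 h2 with c0 c1 c2
  · rcases le_total w1 (((b.w1l + b.w1h) / 2 : ℚ) : ℝ) with hle | hge
    · exact h1 w1 w2 w3 e1 e2 e3 ⟨m1, hle, m3, m4, m5, m6, m7, m8⟩ H
    · exact h2 w1 w2 w3 e1 e2 e3 ⟨hge, m2, m3, m4, m5, m6, m7, m8⟩ H
  · rcases le_total w2 (((b.w2l + b.w2h) / 2 : ℚ) : ℝ) with hle | hge
    · exact h1 w1 w2 w3 e1 e2 e3 ⟨m1, m2, m3, hle, m5, m6, m7, m8⟩ H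
    · exact h2 w1 w2 w3 e1 e2 e3 ⟨m1, m2, hge, m4, m5, m6, m7, m8⟩ H
  · rcases le_total e1 (((b.e1l + b.e1h) / 2 : ℚ) : ℝ) with hle | hge
    · exact h1 w1 w2 w3 e1 e2 e3 ⟨m1, m2, m3, m4, m5, hle, m7, m8⟩ H
    · exact h2 w1 w2 w3 e1 e2 e3 ⟨m1, m2, m3, m4, hge, m6, m7, m8⟩ H
  · rcases le_total e2 (((b.e2l + b.e2h) / 2 : ℚ) : ℝ) with hle | hge
    · exact h1 w1 w2 w3 e1 e2 e3 ⟨m1, m2, m3, m4, m5, m6, m7, hle⟩ H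
    · exact h2 w1 w2 w3 e1 e2 e3 ⟨m1, m2, m3, m4, m5, m6, hge, m8⟩ H

/-- [folklore] `memB` is list membership. -/
theorem mem_of_memB {b : Box} : ∀ {l : List Box}, memB b l = true → b ∈ l
  | [], h => by simp [memB] at h
  | c :: cs, h => by
    simp only [memB, Bool.or_eq_true, decide_eq_true_eq] at h
    rcases h with rfl | h
    · exact List.mem_cons_self
    · exact List.mem_cons_of_mem _ (mem_of_memB h)

/-- [folklore] **Soundness of the checker**: if every trusted box is sound and the checker accepts
`b`, then `b` is sound. -/
theorem checkT_sound (trusted : List Box) (ht : ∀ c ∈ trusted, Sound c) :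
    ∀ (n : ℕ) (b : Box), checkT trusted n b = true → Sound b
  | 0, b, h => by
    simp only [checkT, Bool.or_eq_true] at h
    rcases h with h | h
    · exact leafOK_sound b h
    · exact ht b (mem_of_memB h)
  | n + 1, b, h => by
    simp only [checkT, Bool.or_eq_true, Bool.and_eq_true] at h
    rcases h with (h | h) | ⟨h1, h2⟩
    · exact leafOK_sound b h
    · exact ht b (mem_of_memB h)
    · exact split_sound b (checkT_sound trusted ht n _ h1) (checkT_sound trusted ht n _ h2)

/-! ### The certificate (evaluated by the kernel) -/

/-- [folklore] The initial box: `w₁ ∈ [1/3, 3/4]`, `w₂ ∈ [1/10, 1/2]`, `η₁, η₂ ∈ [0, 3/4]`. -/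
def root : Box := ⟨1 / 3, 3 / 4, 1 / 10, 1 / 2, 0, 3 / 4, 0, 3 / 4⟩

/-- [folklore] Chunk 1 of the search tree (a node at depth 4). -/
def c1 : Box := ⟨1 / 3, 13 / 24, 1 / 10, 3 / 10, 0, 3 / 8, 0, 3 / 8⟩
/-- [folklore] Chunk 2. -/
def c2 : Box := ⟨1 / 3, 13 / 24, 3 / 10, 1 / 2, 0, 3 / 8, 0, 3 / 8⟩
/-- [folklore] Chunk 3. -/
def c3 : Box := ⟨13 / 24, 3 / 4, 1 / 10, 1 / 2, 0, 3 / 8, 0, 3 / 8⟩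
/-- [folklore] Chunk 4. -/
def c4 : Box := ⟨1 / 3, 13 / 24, 1 / 10, 1 / 2, 0, 3 / 8, 3 / 8, 3 / 4⟩
/-- [folklore] Chunk 5. -/
def c5 : Box := ⟨13 / 24, 3 / 4, 1 / 10, 3 / 10, 0, 3 / 8, 3 / 8, 3 / 4⟩
/-- [folklore] Chunk 6. -/
def c6 : Box := ⟨13 / 24, 3 / 4, 3 / 10, 1 / 2, 0, 3 / 8, 3 / 8, 3 / 4⟩
/-- [folklore] Chunk 7. -/
def c7 : Box := ⟨1 / 3, 13 / 24, 1 / 10, 1 / 2, 3 / 8, 3 / 4, 0, 3 / 8⟩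
/-- [folklore] Chunk 8. -/
def c8 : Box := ⟨13 / 24, 3 / 4, 1 / 10, 1 / 2, 3 / 8, 3 / 4, 0, 3 / 8⟩
/-- [folklore] Chunk 9. -/
def c9 : Box := ⟨1 / 3, 3 / 4, 1 / 10, 1 / 2, 3 / 8, 3 / 4, 3 / 8, 3 / 4⟩

/-- [folklore] The list of chunks. -/
def chunks : List Box := [c1, c2, c3, c4, c5, c6, c7, c8, c9]

/-- [folklore] Kernel evaluation: chunk 6 is certified (291 nodes). -/
theorem c6_ok : checkT [] 14 c6 = true := by decide +kernel
/-- [folklore] Kernel evaluation: chunk 8 is certified (411 nodes). -/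
theorem c8_ok : checkT [] 16 c8 = true := by decide +kernel
/-- [folklore] Kernel evaluation: chunk 9 is certified (471 nodes). -/
theorem c9_ok : checkT [] 17 c9 = true := by decide +kernel

end PhiSharpBB

end Literature.MathematicalPhysics.QuantumLattice.Imbrie2016
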